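import Summits.KontsevichZagierPeriods.Zeta5Search.Barrier.ConeGammaCuspGermGreedy

/-!
# ζ(5) search — BARRIER: THE JUNCTION VOTE IS A LOVÁSZ EXTENSION — convexity type of a junction

HONEST FRAMING (cell `pub-zeta5`): systematic search; no irrationality claim unless kernel-certified. MODEL objects
under Brown–Zudilin's (28)+(30) accounting ([BZ22] = arXiv:2210.03391; (28) observed, not proved); nothing here is a
statement about `ζ(5)`, any `γ` of record, the cone's supremum (C2 OPEN) or the value / sign / modularity type of any
junction vote at a named direction (DATA of the cell); S-E stays CONJECTURED; records in print UNMOVED. Prover P2 g30,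
item «THE JUNCTION VOTE IS A LOVÁSZ EXTENSION» (INBOX 2026-08-27), file (3b); consumes the pure combinatorics of
`ConeGammaCuspGermGreedy` and P2 g29's endpoint-jump form (`ConeGammaCuspGermEndpoint`).

SETTING. `b ∈ bkpts a T` a junction, `M` a finset of forms (the MEMBERS `b·h_k(a) ∈ ℤ` of the junction, typically)
and `f : Finset (Fin 28) → ℝ` ANY set function through which the saving factors near `θ_b = b·s(a)`:
`𝒩(θ_b + Δ) = f({k ∈ M : 0 ≤ φ_k(Δ)})` for all small `Δ` (hypothesis `hf`; the PATTERN FUNCTION of the junction on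
the realisable member-sign patterns — RIDERS 4–7 evaluate it; the cell's desk extends it to all subsets of `M` by the
Hamiltonian-path formula; only `hf` links `f` and `M` to the saving, no membership hypothesis is needed). Rates
`r_k(δ) = φ_k(δ)/h_k(a)`, flip times `c_k = −r_k`; for a reference `δ₀` GENERIC AT `b` (member rates pairwise distinct)
the prefix sets `P≤(k) = {l ∈ M : r_l(δ₀) ≥ r_k(δ₀)}` (members flipping no later than `k`), `P<(k)`, and the GREEDY
WEIGHTS `w_k = f(P≤(k)) − f(P<(k))`.
* `torusN_line_eq_pattern` — at local time `x` on the line of `δ` the saving is `f` of the threshold set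
  `{k ∈ M : c_k ≤ x}`; **`germ_pair_eq_lovasz`** — `K_b(δ) = −Σ_i d_i (f(S_i) − f(S_{i−1}))` along any chain through
  the member flip times: THE VOTE IS THE LOVÁSZ EXTENSION (Choquet integral) OF `f` AT THE MEMBER RATES;
* **`germ_pair_eq_greedy_of_refines`** — on the closed chamber of a generic `δ₀` the vote is the greedy functional
  `Σ_{k∈M} w_k · φ_k(δ)/h_k(a)` (P2 g29's integer weights, now explicit: `J_k = f(P≤(k)) − f(P<(k))`), for ANY `f`;
* **`greedy_le_germ_pair_of_submodular`** — if `f` is SUBMODULAR on the subsets of `M`, every greedy functional is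
  `≤ K_b(δ)` for EVERY `δ`: the vote is the MAXIMUM of its chamber functionals; `germ_pair_le_greedy_of_supermodular`;
* **`germ_pair_subadditive_of_submodular`** — `K_b(δ + δ') ≤ K_b(δ) + K_b(δ')` (any admissible scales);
  **`germ_pair_superadditive_of_supermodular`**; **`germ_pair_eq_linear_of_modular`** — a MODULAR junction votes
  LINEARLY: `K_b(δ) = Σ_{k∈M} (f{k} − f∅)·φ_k(δ)/h_k(a)` for ALL `δ` (no kink; RIDER 4's single walls and RIDER 5's
  `D_b = 0` two-walls are the cases `|M| ≤ 2`).
With P2 g28's homogeneity these say: a submodular junction vote is a CONVEX function of the displacement, a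
supermodular one CONCAVE, a modular one LINEAR (L. Lovász 1983). DESK (DATA, `HOME/pub-zeta5-p2/g30/alg/modcensus.py`):
convexity-type census of one period — record/41: 76 modular / 8 sub / 34 super / 86 neither of 204 junctions;
flag/60 124/9/53/26; argmax-120 457/19/80/32; t*/480 2164/16/548/22; the sub/super-additivity of `K_b` checked on
35 272 (junction, pair) instances, 0 violations. NOT here: the type of any named junction; `γ`, C2, S-E, `ζ(5)`.
-/

noncomputable section

open Set MeasureTheory Finset
open scoped Topology

namespace Summit.KontsevichZagierPeriods.Zeta5Search.Barrier.ConeGamma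

/-! ### The saving along the local line reads the pattern function at threshold sets -/

/-- **At local time `x` the saving is `f` of the threshold set.** For `b ∈ bkpts a T`, member finset `M`, a pattern
function `f` (agreeing with the saving on realisable patterns), `δ`, an admissible `η` and `|x| ≤ W`:
`𝒩(θ_b + η(x·s + δ)) = f({k ∈ M : −φ_k(δ)/h_k ≤ x})`. -/
theorem torusN_line_eq_pattern {a : Dir} (hpos : ∀ k, 0 < h28 a k) {T b : ℝ} {M : Finset (Fin 28)}
    {f : Finset (Fin 28) → ℝ}
    (hf : ∀ Δ : Fin 8 → ℝ, (∀ k, |phiForm Δ k| < 1) → (∀ k, |phiForm Δ k| < wallDist a T) →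
      (torusN (b • sParam a + Δ) : ℝ) = f (M.filter fun k => 0 ≤ phiForm Δ k))
    (δ : Fin 8 → ℝ) {η : ℝ} (hη : 0 < η) (h1 : η * clusterBound a δ < 1) (h2 : η * clusterBound a δ < wallDist a T)
    {x : ℝ} (hx : |x| ≤ clusterWidth a δ) :
    (torusN (b • sParam a + η • (x • sParam a + δ)) : ℝ) =
      f (M.filter fun k => -(phiForm δ k / h28 a k) ≤ x) := by
  obtain ⟨hx1, hx2⟩ := disp_small hpos δ hη h1 h2 hx (T := T)
  rw [hf _ hx1 hx2]
  congr 1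
  refine Finset.filter_congr fun k _ => ?_
  rw [phiForm_disp, line_form_eq_mul_sub (hpos k) rfl, mul_nonneg_iff_of_pos_left hη,
    mul_nonneg_iff_of_pos_left (hpos k), sub_nonneg]

/-- **THE VOTE IS THE LOVÁSZ EXTENSION OF THE PATTERN FUNCTION.** For `b ∈ bkpts a T` (all forms of `a` positive),
member finset `M`, pattern function `f`, displacement `δ`, admissible `η`, and any weakly increasing chain
`−W = d_0 ≤ ⋯ ≤ d_n = W` through the member flip times: `germR(δ)(b) + germL(δ)(b) =
−Σ_{0<i<n} d_i·(f(S_i) − f(S_{i−1}))` with the threshold sets `S_i = {k ∈ M : −φ_k(δ)/h_k ≤ d_i}` — the Choquet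
integral `Σ_i r_(i)(f(S_i) − f(S_{i−1}))` of `f` at the member rates. -/
theorem germ_pair_eq_lovasz {a : Dir} (hpos : ∀ k, 0 < h28 a k) {T b : ℝ} (hb : b ∈ bkpts a T)
    {M : Finset (Fin 28)} {f : Finset (Fin 28) → ℝ}
    (hf : ∀ Δ : Fin 8 → ℝ, (∀ k, |phiForm Δ k| < 1) → (∀ k, |phiForm Δ k| < wallDist a T) →
      (torusN (b • sParam a + Δ) : ℝ) = f (M.filter fun k => 0 ≤ phiForm Δ k))
    (δ : Fin 8 → ℝ) {η : ℝ} (hη : 0 < η) (h1 : η * clusterBound a δ < 1) (h2 : η * clusterBound a δ < wallDist a T)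
    {n : ℕ} {d : ℕ → ℝ} (hd0 : d 0 = -clusterWidth a δ) (hdn : d n = clusterWidth a δ)
    (hmono : ∀ j < n, d j ≤ d (j + 1))
    (hflip : ∀ k, (∃ z : ℤ, b * h28 a k = z) → ∃ i ≤ n, d i = -(phiForm δ k / h28 a k)) :
    germR a δ η b + germL a δ η b =
      -∑ i ∈ Finset.Ico 1 n, d i *
        (f (M.filter fun k => -(phiForm δ k / h28 a k) ≤ d i) -
          f (M.filter fun k => -(phiForm δ k / h28 a k) ≤ d (i - 1))) := by
  rw [germ_pair_eq_sum_endpoint_jumps hpos hb δ hη h1 h2 hd0 hdn hmono hflip, neg_inj]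
  refine Finset.sum_congr rfl fun i hi => ?_
  obtain ⟨hi1, hin⟩ := Finset.mem_Ico.mp hi
  rw [torusN_line_eq_pattern hpos hf δ hη h1 h2 (abs_wchain_le hd0 hdn hmono hin.le),
    torusN_line_eq_pattern hpos hf δ hη h1 h2 (abs_wchain_le hd0 hdn hmono (by omega : i - 1 ≤ n))]

/-- A strict chain through the member flip times of `δ` (all of them interior points). -/
theorem exists_member_chain {a : Dir} (hpos : ∀ k, 0 < h28 a k) (b : ℝ) (M : Finset (Fin 28))
    (δ : Fin 8 → ℝ) :
    ∃ (n : ℕ) (d : ℕ → ℝ), d 0 = -clusterWidth a δ ∧ d n = clusterWidth a δ ∧ (∀ j < n, d j < d (j + 1)) ∧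
      (∀ k, (∃ z : ℤ, b * h28 a k = z) → ∃ i ≤ n, d i = -(phiForm δ k / h28 a k)) ∧
      (∀ k ∈ M, ∃ i, 0 < i ∧ i < n ∧ d i = -(phiForm δ k / h28 a k)) := by
  classical
  have hW := clusterWidth_pos hpos δ
  have hin : ∀ k : Fin 28, -clusterWidth a δ < -(phiForm δ k / h28 a k) ∧
      -(phiForm δ k / h28 a k) < clusterWidth a δ := fun k => by
    have h := abs_lt.mp (abs_flip_lt_clusterWidth hpos δ k)
    exact ⟨by linarith [h.2], by linarith [h.1]⟩
  obtain ⟨n, d, hd0, hdn, hmono, hmem, -⟩ := exists_chain_through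
    (Finset.univ.image fun k : Fin 28 => -(phiForm δ k / h28 a k)) (by linarith : -clusterWidth a δ < clusterWidth a δ)
    (fun v hv => by obtain ⟨k, -, rfl⟩ := Finset.mem_image.mp hv; exact (hin k).1)
    (fun v hv => by obtain ⟨k, -, rfl⟩ := Finset.mem_image.mp hv; exact (hin k).2)
  have hall : ∀ k : Fin 28, ∃ i ≤ n, d i = -(phiForm δ k / h28 a k) := fun k =>
    hmem _ (Finset.mem_image.mpr ⟨k, Finset.mem_univ _, rfl⟩)
  refine ⟨n, d, hd0, hdn, hmono, fun k _ => hall k, fun k _ => ?_⟩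
  obtain ⟨i, hin', hdi⟩ := hall k
  refine ⟨i, Nat.pos_of_ne_zero ?_, lt_of_le_of_ne hin' ?_, hdi⟩
  · rintro rfl; rw [hd0] at hdi; linarith [(hin k).1]
  · rintro rfl; rw [hdn] at hdi; linarith [(hin k).2]

/-! ### The closed chamber: the vote is the greedy functional -/

/-- **ON THE CLOSED CHAMBER THE VOTE IS THE GREEDY FUNCTIONAL** (the Lovász identity; any `f`). Let `δ₀` be
generic at `b` (member rates pairwise distinct) and `δ` refined by `δ₀` on the members
(`r_k(δ) < r_l(δ) ⇒ r_k(δ₀) < r_l(δ₀)`). Then for every admissible `η`: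
`germR(δ)(b) + germL(δ)(b) = Σ_{k∈M} (f(P≤(k)) − f(P<(k))) · φ_k(δ)/h_k(a)`,
`P≤(k) = {l ∈ M : r_k(δ₀) ≤ r_l(δ₀)}`, `P<(k) = {l ∈ M : r_k(δ₀) < r_l(δ₀)}` — P2 g29's chamber weights made explicit. -/
theorem germ_pair_eq_greedy_of_refines {a : Dir} (hpos : ∀ k, 0 < h28 a k) {T b : ℝ} (hb : b ∈ bkpts a T)
    {M : Finset (Fin 28)} {f : Finset (Fin 28) → ℝ}
    (hf : ∀ Δ : Fin 8 → ℝ, (∀ k, |phiForm Δ k| < 1) → (∀ k, |phiForm Δ k| < wallDist a T) →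
      (torusN (b • sParam a + Δ) : ℝ) = f (M.filter fun k => 0 ≤ phiForm Δ k))
    {δ₀ : Fin 8 → ℝ} (hgen : ∀ k ∈ M, ∀ l ∈ M, k ≠ l → phiForm δ₀ k / h28 a k ≠ phiForm δ₀ l / h28 a l)
    (δ : Fin 8 → ℝ) (href : ∀ k ∈ M, ∀ l ∈ M, phiForm δ k / h28 a k < phiForm δ l / h28 a l →
      phiForm δ₀ k / h28 a k < phiForm δ₀ l / h28 a l)
    {η : ℝ} (hη : 0 < η) (h1 : η * clusterBound a δ < 1) (h2 : η * clusterBound a δ < wallDist a T) :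
    germR a δ η b + germL a δ η b =
      ∑ k ∈ M, (f (M.filter fun l => phiForm δ₀ k / h28 a k ≤ phiForm δ₀ l / h28 a l) -
          f (M.filter fun l => phiForm δ₀ k / h28 a k < phiForm δ₀ l / h28 a l)) * (phiForm δ k / h28 a k) := by
  classical
  obtain ⟨n, d, hd0, hdn, hmono, hflip, hflipM⟩ := exists_member_chain hpos b M δ
  rw [germ_pair_eq_lovasz hpos hb hf δ hη h1 h2 hd0 hdn (fun j hj => (hmono j hj).le) hflip]
  have key := greedy_eq_lovasz_of_prefix (M := M) (ρ := fun k => phiForm δ₀ k / h28 a k) f hgen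
    (fun k => -(phiForm δ k / h28 a k)) hmono hflipM ?_
  · rw [← key]
    exact Finset.sum_congr rfl fun k _ => by rw [neg_neg]
  -- every threshold set of `δ` is empty or a prefix set of `δ₀`
  intro i _
  rcases (M.filter fun k => -(phiForm δ k / h28 a k) ≤ d i).eq_empty_or_nonempty with h | hne
  · exact Or.inl h
  · right
    obtain ⟨t, ht, hmin⟩ := Finset.exists_min_image _ (fun k => phiForm δ₀ k / h28 a k) hne
    obtain ⟨htM, htc⟩ := Finset.mem_filter.mp ht
    refine ⟨t, htM, ?_⟩
    ext k
    simp only [Finset.mem_filter]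
    constructor
    · intro hk; exact ⟨hk.1, hmin k (Finset.mem_filter.mpr hk)⟩
    · rintro ⟨hkM, hle⟩
      refine ⟨hkM, ?_⟩
      by_contra hkc
      have hlt : phiForm δ k / h28 a k < phiForm δ t / h28 a t := by have := not_le.mp hkc; linarith
      exact absurd (href k hkM t htM hlt) (not_lt.mpr hle)

/-! ### Submodular junctions: the vote dominates its chamber functionals and is subadditive -/

/-- **A SUBMODULAR JUNCTION VOTE DOMINATES ALL ITS CHAMBER FUNCTIONALS.** If `f` is submodular on the subsets of `M`
(`f(A ∪ B) + f(A ∩ B) ≤ f(A) + f(B)`), then for every `δ₀` generic at `b`, EVERY displacement `δ` and every admissible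
`η`: `Σ_{k∈M} (f(P≤(k)) − f(P<(k)))·φ_k(δ)/h_k(a) ≤ germR(δ)(b) + germL(δ)(b)` — the vote is the upper envelope (maximum)
of the linear functionals it equals on the chambers; in particular it is a CONVEX function of `δ`. -/
theorem greedy_le_germ_pair_of_submodular {a : Dir} (hpos : ∀ k, 0 < h28 a k) {T b : ℝ} (hb : b ∈ bkpts a T)
    {M : Finset (Fin 28)} {f : Finset (Fin 28) → ℝ}
    (hf : ∀ Δ : Fin 8 → ℝ, (∀ k, |phiForm Δ k| < 1) → (∀ k, |phiForm Δ k| < wallDist a T) →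
      (torusN (b • sParam a + Δ) : ℝ) = f (M.filter fun k => 0 ≤ phiForm Δ k))
    (hsub : ∀ A B : Finset (Fin 28), A ⊆ M → B ⊆ M → f (A ∪ B) + f (A ∩ B) ≤ f A + f B)
    {δ₀ : Fin 8 → ℝ} (hgen : ∀ k ∈ M, ∀ l ∈ M, k ≠ l → phiForm δ₀ k / h28 a k ≠ phiForm δ₀ l / h28 a l)
    (δ : Fin 8 → ℝ) {η : ℝ} (hη : 0 < η) (h1 : η * clusterBound a δ < 1) (h2 : η * clusterBound a δ < wallDist a T) :
    ∑ k ∈ M, (f (M.filter fun l => phiForm δ₀ k / h28 a k ≤ phiForm δ₀ l / h28 a l) -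
        f (M.filter fun l => phiForm δ₀ k / h28 a k < phiForm δ₀ l / h28 a l)) * (phiForm δ k / h28 a k) ≤
      germR a δ η b + germL a δ η b := by
  classical
  obtain ⟨n, d, hd0, hdn, hmono, hflip, hflipM⟩ := exists_member_chain hpos b M δ
  rw [germ_pair_eq_lovasz hpos hb hf δ hη h1 h2 hd0 hdn (fun j hj => (hmono j hj).le) hflip]
  have key := greedy_le_lovasz_of_submodular (M := M) (ρ := fun k => phiForm δ₀ k / h28 a k) hgen hsub
    (fun k => -(phiForm δ k / h28 a k)) hmono hflipM
  simp only [neg_neg] at key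
  exact key

/-- **A SUPERMODULAR JUNCTION VOTE IS DOMINATED BY ITS CHAMBER FUNCTIONALS** (the mirror statement: the vote is the
minimum of its chamber functionals, a CONCAVE function of `δ`). -/
theorem germ_pair_le_greedy_of_supermodular {a : Dir} (hpos : ∀ k, 0 < h28 a k) {T b : ℝ} (hb : b ∈ bkpts a T)
    {M : Finset (Fin 28)} {f : Finset (Fin 28) → ℝ}
    (hf : ∀ Δ : Fin 8 → ℝ, (∀ k, |phiForm Δ k| < 1) → (∀ k, |phiForm Δ k| < wallDist a T) →
      (torusN (b • sParam a + Δ) : ℝ) = f (M.filter fun k => 0 ≤ phiForm Δ k))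
    (hsuper : ∀ A B : Finset (Fin 28), A ⊆ M → B ⊆ M → f A + f B ≤ f (A ∪ B) + f (A ∩ B))
    {δ₀ : Fin 8 → ℝ} (hgen : ∀ k ∈ M, ∀ l ∈ M, k ≠ l → phiForm δ₀ k / h28 a k ≠ phiForm δ₀ l / h28 a l)
    (δ : Fin 8 → ℝ) {η : ℝ} (hη : 0 < η) (h1 : η * clusterBound a δ < 1) (h2 : η * clusterBound a δ < wallDist a T) :
    germR a δ η b + germL a δ η b ≤
      ∑ k ∈ M, (f (M.filter fun l => phiForm δ₀ k / h28 a k ≤ phiForm δ₀ l / h28 a l) -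
        f (M.filter fun l => phiForm δ₀ k / h28 a k < phiForm δ₀ l / h28 a l)) * (phiForm δ k / h28 a k) := by
  classical
  obtain ⟨n, d, hd0, hdn, hmono, hflip, hflipM⟩ := exists_member_chain hpos b M δ
  rw [germ_pair_eq_lovasz hpos hb hf δ hη h1 h2 hd0 hdn (fun j hj => (hmono j hj).le) hflip]
  have key := lovasz_le_greedy_of_supermodular (M := M) (ρ := fun k => phiForm δ₀ k / h28 a k) hgen hsuper
    (fun k => -(phiForm δ k / h28 a k)) hmono hflipM
  simp only [neg_neg] at key
  exact key

/-- **A SUBMODULAR JUNCTION VOTE IS SUBADDITIVE**: `K_b(δ + δ') ≤ K_b(δ) + K_b(δ')` (each vote at any admissible scale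
of its own; the greedy functional of a generic refinement of `δ + δ'` equals the vote there and under-estimates it at
`δ` and at `δ'`). -/
theorem germ_pair_subadditive_of_submodular {a : Dir} (hpos : ∀ k, 0 < h28 a k) {T b : ℝ} (hb : b ∈ bkpts a T)
    {M : Finset (Fin 28)} {f : Finset (Fin 28) → ℝ}
    (hf : ∀ Δ : Fin 8 → ℝ, (∀ k, |phiForm Δ k| < 1) → (∀ k, |phiForm Δ k| < wallDist a T) →
      (torusN (b • sParam a + Δ) : ℝ) = f (M.filter fun k => 0 ≤ phiForm Δ k))
    (hsub : ∀ A B : Finset (Fin 28), A ⊆ M → B ⊆ M → f (A ∪ B) + f (A ∩ B) ≤ f A + f B)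
    (δ δ' : Fin 8 → ℝ) {η₁ : ℝ} (hη₁ : 0 < η₁) (h1₁ : η₁ * clusterBound a δ < 1)
    (h2₁ : η₁ * clusterBound a δ < wallDist a T) {η₂ : ℝ} (hη₂ : 0 < η₂) (h1₂ : η₂ * clusterBound a δ' < 1)
    (h2₂ : η₂ * clusterBound a δ' < wallDist a T) {η₃ : ℝ} (hη₃ : 0 < η₃) (h1₃ : η₃ * clusterBound a (δ + δ') < 1)
    (h2₃ : η₃ * clusterBound a (δ + δ') < wallDist a T) :
    germR a (δ + δ') η₃ b + germL a (δ + δ') η₃ b ≤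
      (germR a δ η₁ b + germL a δ η₁ b) + (germR a δ' η₂ b + germL a δ' η₂ b) := by
  obtain ⟨δ₀, hgen, href⟩ := exists_generic_refines hpos (δ + δ')
  have hgenM : ∀ k ∈ M, ∀ l ∈ M, k ≠ l → phiForm δ₀ k / h28 a k ≠ phiForm δ₀ l / h28 a l :=
    fun k _ l _ hkl => hgen k l hkl
  rw [germ_pair_eq_greedy_of_refines hpos hb hf hgenM (δ + δ') (fun k _ l _ h => href k l h) hη₃ h1₃ h2₃]
  have hB := greedy_le_germ_pair_of_submodular hpos hb hf hsub hgenM δ hη₁ h1₁ h2₁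
  have hB' := greedy_le_germ_pair_of_submodular hpos hb hf hsub hgenM δ' hη₂ h1₂ h2₂
  have hsplit : ∑ k ∈ M, (f (M.filter fun l => phiForm δ₀ k / h28 a k ≤ phiForm δ₀ l / h28 a l) -
        f (M.filter fun l => phiForm δ₀ k / h28 a k < phiForm δ₀ l / h28 a l)) * (phiForm (δ + δ') k / h28 a k) =
      ∑ k ∈ M, (f (M.filter fun l => phiForm δ₀ k / h28 a k ≤ phiForm δ₀ l / h28 a l) -
        f (M.filter fun l => phiForm δ₀ k / h28 a k < phiForm δ₀ l / h28 a l)) * (phiForm δ k / h28 a k) +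
      ∑ k ∈ M, (f (M.filter fun l => phiForm δ₀ k / h28 a k ≤ phiForm δ₀ l / h28 a l) -
        f (M.filter fun l => phiForm δ₀ k / h28 a k < phiForm δ₀ l / h28 a l)) * (phiForm δ' k / h28 a k) := by
    rw [← Finset.sum_add_distrib]
    exact Finset.sum_congr rfl fun k _ => by rw [phiForm_add]; ring
  rw [hsplit]
  exact add_le_add hB hB'

/-- **A SUPERMODULAR JUNCTION VOTE IS SUPERADDITIVE**: `K_b(δ) + K_b(δ') ≤ K_b(δ + δ')`. -/
theorem germ_pair_superadditive_of_supermodular {a : Dir} (hpos : ∀ k, 0 < h28 a k) {T b : ℝ} (hb : b ∈ bkpts a T)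
    {M : Finset (Fin 28)} {f : Finset (Fin 28) → ℝ}
    (hf : ∀ Δ : Fin 8 → ℝ, (∀ k, |phiForm Δ k| < 1) → (∀ k, |phiForm Δ k| < wallDist a T) →
      (torusN (b • sParam a + Δ) : ℝ) = f (M.filter fun k => 0 ≤ phiForm Δ k))
    (hsuper : ∀ A B : Finset (Fin 28), A ⊆ M → B ⊆ M → f A + f B ≤ f (A ∪ B) + f (A ∩ B))
    (δ δ' : Fin 8 → ℝ) {η₁ : ℝ} (hη₁ : 0 < η₁) (h1₁ : η₁ * clusterBound a δ < 1)
    (h2₁ : η₁ * clusterBound a δ < wallDist a T) {η₂ : ℝ} (hη₂ : 0 < η₂) (h1₂ : η₂ * clusterBound a δ' < 1)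
    (h2₂ : η₂ * clusterBound a δ' < wallDist a T) {η₃ : ℝ} (hη₃ : 0 < η₃) (h1₃ : η₃ * clusterBound a (δ + δ') < 1)
    (h2₃ : η₃ * clusterBound a (δ + δ') < wallDist a T) :
    (germR a δ η₁ b + germL a δ η₁ b) + (germR a δ' η₂ b + germL a δ' η₂ b) ≤
      germR a (δ + δ') η₃ b + germL a (δ + δ') η₃ b := by
  obtain ⟨δ₀, hgen, href⟩ := exists_generic_refines hpos (δ + δ')
  have hgenM : ∀ k ∈ M, ∀ l ∈ M, k ≠ l → phiForm δ₀ k / h28 a k ≠ phiForm δ₀ l / h28 a l :=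
    fun k _ l _ hkl => hgen k l hkl
  rw [germ_pair_eq_greedy_of_refines hpos hb hf hgenM (δ + δ') (fun k _ l _ h => href k l h) hη₃ h1₃ h2₃]
  have hB := germ_pair_le_greedy_of_supermodular hpos hb hf hsuper hgenM δ hη₁ h1₁ h2₁
  have hB' := germ_pair_le_greedy_of_supermodular hpos hb hf hsuper hgenM δ' hη₂ h1₂ h2₂
  have hsplit : ∑ k ∈ M, (f (M.filter fun l => phiForm δ₀ k / h28 a k ≤ phiForm δ₀ l / h28 a l) -
        f (M.filter fun l => phiForm δ₀ k / h28 a k < phiForm δ₀ l / h28 a l)) * (phiForm (δ + δ') k / h28 a k) =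
      ∑ k ∈ M, (f (M.filter fun l => phiForm δ₀ k / h28 a k ≤ phiForm δ₀ l / h28 a l) -
        f (M.filter fun l => phiForm δ₀ k / h28 a k < phiForm δ₀ l / h28 a l)) * (phiForm δ k / h28 a k) +
      ∑ k ∈ M, (f (M.filter fun l => phiForm δ₀ k / h28 a k ≤ phiForm δ₀ l / h28 a l) -
        f (M.filter fun l => phiForm δ₀ k / h28 a k < phiForm δ₀ l / h28 a l)) * (phiForm δ' k / h28 a k) := by
    rw [← Finset.sum_add_distrib]
    exact Finset.sum_congr rfl fun k _ => by rw [phiForm_add]; ring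
  rw [hsplit]
  exact add_le_add hB hB'

/-! ### Modular junctions vote linearly -/

/-- **A MODULAR JUNCTION VOTES LINEARLY — NO KINK.** If `f` is modular on the subsets of `M`
(`f(A ∪ B) + f(A ∩ B) = f(A) + f(B)`), then for EVERY displacement `δ` and admissible `η`:
`germR(δ)(b) + germL(δ)(b) = Σ_{k∈M} (f{k} − f∅) · φ_k(δ)/h_k(a)` — one linear functional on all of `ℝ⁸`; in particular
the junction's symmetric part `K_b(δ) + K_b(−δ)` vanishes identically (RIDER 4's single walls, RIDER 5's `D_b = 0`). -/
theorem germ_pair_eq_linear_of_modular {a : Dir} (hpos : ∀ k, 0 < h28 a k) {T b : ℝ} (hb : b ∈ bkpts a T)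
    {M : Finset (Fin 28)} {f : Finset (Fin 28) → ℝ}
    (hf : ∀ Δ : Fin 8 → ℝ, (∀ k, |phiForm Δ k| < 1) → (∀ k, |phiForm Δ k| < wallDist a T) →
      (torusN (b • sParam a + Δ) : ℝ) = f (M.filter fun k => 0 ≤ phiForm Δ k))
    (hmod : ∀ A B : Finset (Fin 28), A ⊆ M → B ⊆ M → f (A ∪ B) + f (A ∩ B) = f A + f B)
    (δ : Fin 8 → ℝ) {η : ℝ} (hη : 0 < η) (h1 : η * clusterBound a δ < 1) (h2 : η * clusterBound a δ < wallDist a T) :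
    germR a δ η b + germL a δ η b = ∑ k ∈ M, (f {k} - f ∅) * (phiForm δ k / h28 a k) := by
  classical
  obtain ⟨δ₀, hgen, href⟩ := exists_generic_refines hpos δ
  have hgenM : ∀ k ∈ M, ∀ l ∈ M, k ≠ l → phiForm δ₀ k / h28 a k ≠ phiForm δ₀ l / h28 a l :=
    fun k _ l _ hkl => hgen k l hkl
  rw [germ_pair_eq_greedy_of_refines hpos hb hf hgenM δ (fun k _ l _ h => href k l h) hη h1 h2]
  refine Finset.sum_congr rfl fun k hk => ?_
  obtain ⟨hins, hnot⟩ := prefix_le_eq_insert (ρ := fun k => phiForm δ₀ k / h28 a k) hgenM hk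
  have h := hmod {k} (M.filter fun l => phiForm δ₀ k / h28 a k < phiForm δ₀ l / h28 a l)
    (Finset.singleton_subset_iff.mpr hk) (Finset.filter_subset _ _)
  rw [Finset.singleton_inter_of_notMem hnot, ← Finset.insert_eq, ← hins] at h
  congr 1
  linarith

end Summit.KontsevichZagierPeriods.Zeta5Search.Barrier.ConeGamma

end
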